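import Summits.QuantumFields.YangMills.Theorems.BalabanUVNodesN20TwoRunKeyedPersistentWeight

/-!
# BalabanUVNodes ∕ N20 (NE7b) — WHAT THE RUN-B FIBRE IN THE `hedge` SANDWICH RANGES OVER: node U5d's block-down fibre `{s′ : truncSeq s′ = s}` over a run-A
# (2.18) sequence `s` IS run B's ADMISSIBLE LEVEL-1 DATA `(Ω′_1 ⊇ Λ′_1 ⊇ blockUp Ω_1)` — a bijection —, the higher entries being forced to `blockUp` of `s`'s
# (module 3 of this seat's `hedge`-companion; the partial summation of [King1986] (3.10) read on the tree's objects)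

Cell `pub-ymgap` (HUMAN RULING D-0062 Track A; D-0149 width push), seat `pub-ymgap-dag-n20-w3` (WIDTH SEAT 3 of 3 on NODE n20 = NE7b) gen 0; continuation of modules 1–2
`Thm/BalabanUVNodesN20CoreEdgeTwoRunKeyed` ∕ `…N20CoreEdgeAtPersistentKeys` (W-SEAT-START-LIST v3 §2 n20 item 3 as re-pointed by plan g77 l.24047: the `hedge`-joint
companion).  Filed `--kind proof --supports stmt-QuantumFields-20544 --as helper`; COUNT-NEUTRAL.  [III] = [Balaban1988Convergent], [LF-I] = [Balaban1989LargeFieldI].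

WHY THIS FILE.  Module 1's ★★ `core_twoRunKeyed_iff_termwise` displays N19's core edge at n19-d's two-run keyed data as a sandwich of run A's (2.18) term `s` (cutoff `K`)
against the SUM of run B's (2.18) terms `s′` (cutoff `K + 1`) over the fibre `{s′ : truncSeq F ν hM hR s′ = s}` of node U5d's block-down truncation
(`Node00/TwoRunSiteTransport.truncSeq`: «drop level 1, block the other entries down by `L`»).  Whoever proves that sandwich (N19's NE7 content) must know what the
fibre IS.  dag-n20-d's `Node00/TwoRunSiteLift` exhibits ONE point of it (the section `liftSeq s`, level 1 := the whole torus) and surjectivity; this file describes the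
WHOLE fibre:
* §1 `truncSeq_eq_iff_blockDown` — `truncSeq s′ = s` iff `blockDown (s′.Ω_{j+1}) = s.Ω_j` and `blockDown (s′.Λ_{j+1}) = s.Λ_j` on the window (definitional), and
  `succ_eq_blockUpSet_of_truncSeq_eq` — on the fibre EVERY entry above level 1 is FORCED, `s′.Ω_{j+1} = blockUp (s.Ω_j)`, `s′.Λ_{j+1} = blockUp (s.Λ_j)`, by n20-w2's
  LANDED exactness `blockUpSet_blockDownSet_of_mem_dOfRecord_succ` (p584315; the `iff` «fibre equations» and the good-class singleton are n20-w2's INTENT-2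
  `…N20TwoRunKeyedGoodFibre` — cited, not re-declared);
* §2 `injOn_levelOne_truncSeq_fibre` — two fibre points with the same level-1 data `(Ω′_1, Λ′_1)` are EQUAL;
* §3 ★ `exists_truncSeq_eq_of_levelOne` — every admissible level-1 datum — `Ω′_1, Λ′_1 ∈ 𝐃^B_1`, `Λ′_1 ⊆ Ω′_1`, and the one (2.1) chain clause that touches it,
  `blockUp (s.Ω_1) ⊆ Λ′_1` when `k ≥ 1` — IS the level-1 datum of a fibre point (construction: `Seq.ofChain` on «level 1 := the datum, level `j+1` := `blockUp` of
  level `j` of `s`», the chain laws as in n20-d's `chain21_liftFun`; no exactness needed);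
* §4 ★★ `bijOn_levelOne_truncSeq_fibre` — `s′ ↦ (s′.Ω_1, s′.Λ_1)` is a BIJECTION from the fibre onto those data (`Set.BijOn`): node U5d's partial summation
  «into run A's classes» sums run B's (2.18) terms over ITS FIRST-LEVEL small-∕large-field decomposition above `s` — [King1986] (3.10)'s «integrate out the first step»
  read on [III]'s index; the no-large-field datum `(T_η, T_η)` is n20-d's `liftSeq s` (`levelOne_liftSeq`).

HONEST FRAMING.  Count-neutral set-level bookkeeping on the tree's (2.18) index (`B14.Eq218Concrete.Seq`, `Node00/TwoRunSite{Transport,Lift}` BY NAME; nothing re-typed; n20-w2's landed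
torus exactness consumed BY NAME).  No weight, no estimate; nothing of Bałaban's asserted; NE7 ∕ NE7b NOT PRINTED ∕ NOT
PROVED; (α)-instance 0∕1; N19 ∕ N20 NOT discharged; K3⁷ NOT closed; counts unmoved (typed 28∕28 · discharged 5∕27); no count claim.  One finite `𝕋⁴_{L^K}` programme at fixed
`ε = L^{−K}` along two consecutive cutoffs, Bałaban AS PRINTED; the YM mass gap (Clay) is NOT proved by any of this — R4 closes the conditional finite-𝕋⁴ rung `BalabanLadder.UV`
only; NOT ℝ⁴, NOT OS.  No `instance`, no `notation`, no `def`, no `sorry`.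
Sources (bookkeeping): [III] (2.1) p.254, (2.5) p.255, (2.18) p.257; [Balaban1987RG1] (0.3) p.252 (block maps); [King1986] (3.10) p.656; [LF-I] (0.2) p.176.
-/

noncomputable section

namespace Summit.QuantumFields.YangMills.BalabanUVNodes.N20TruncSeqFibreLevelOne

open Literature.MathematicalPhysics.QuantumFieldTheory.Balaban1983to89 Literature.MathematicalPhysics.QuantumFieldTheory.Balaban1983to89.Node00
open T4Continuum B14.Eq218Concrete
open Summit.QuantumFields.YangMills.BalabanUVNodes.N20TwoRunKeyedPersistentWeight (blockUpSet_blockDownSet_of_mem_dOfRecord_succ)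

variable (F : T4Family) (ν : Stage7Numerics) {M : ℕ} {gA gB : ℕ → ℝ} {K k : ℕ}

/-! ## §1 The fibre equations: block-down form (definitional); the entries above level 1 are forced -/

/-- **THE FIBRE OF THE BLOCK-DOWN TRUNCATION, BLOCK-DOWN FORM**: `truncSeq s′ = s` iff on the window `blockDown (s′.Ω_{j+1}) = s.Ω_j` and `blockDown (s′.Λ_{j+1}) = s.Λ_j`
(`truncSeq_Ω ∕ _Λ` + `Seq.ext'`; off the window both sides are `∅`). [cite: Balaban1988Convergent, (2.18) p.257 (bookkeeping)] -/
theorem truncSeq_eq_iff_blockDown (hM : 0 < M) (hR : RAgree F ν gA gB k) (s' : Seq (DOfRecord F ν M gB (K + 1)) (k + 1)) (s : Seq (DOfRecord F ν M gA K) k) :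
    truncSeq F ν hM hR s' = s ↔
      ∀ j, 1 ≤ j → j ≤ k → blockDownSet F K (s'.Ω (j + 1)) = s.Ω j ∧ blockDownSet F K (s'.Λ (j + 1)) = s.Λ j := by
  constructor
  · rintro rfl j h1 hj
    exact ⟨(truncSeq_Ω F ν hM hR s' h1 hj).symm, (truncSeq_Λ F ν hM hR s' h1 hj).symm⟩
  · intro h
    apply Seq.ext'
    · funext j
      by_cases hj : 1 ≤ j ∧ j ≤ k
      · rw [truncSeq_Ω F ν hM hR s' hj.1 hj.2, (h j hj.1 hj.2).1]
      · rw [(truncSeq F ν hM hR s').Ω_off j hj, s.Ω_off j hj]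
    · funext j
      by_cases hj : 1 ≤ j ∧ j ≤ k
      · rw [truncSeq_Λ F ν hM hR s' hj.1 hj.2, (h j hj.1 hj.2).2]
      · rw [(truncSeq F ν hM hR s').Λ_off j hj, s.Λ_off j hj]

/-- ON THE FIBRE EVERY ENTRY ABOVE LEVEL 1 IS FORCED (one direction; the `iff` «fibre equations» are n20-w2's `truncSeq_eq_iff_window`, INTENT-2 l.24558 — cited, not
re-declared): if `truncSeq s′ = s` then `s′.Ω_{j+1} = blockUp (s.Ω_j)` and `s′.Λ_{j+1} = blockUp (s.Λ_j)` on the window, by n20-w2's LANDED exactness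
`blockUpSet_blockDownSet_of_mem_dOfRecord_succ` (p584315: run B's admissible regions are `L`-aligned unions of cubes). [cite: Balaban1988Convergent, (2.1) p.254, (2.18) p.257 (bookkeeping)] -/
theorem succ_eq_blockUpSet_of_truncSeq_eq (hM : 0 < M) (hR : RAgree F ν gA gB k)
    {s' : Seq (DOfRecord F ν M gB (K + 1)) (k + 1)} {s : Seq (DOfRecord F ν M gA K) k} (h : truncSeq F ν hM hR s' = s)
    {j : ℕ} (h1 : 1 ≤ j) (hj : j ≤ k) :
    s'.Ω (j + 1) = blockUpSet F K (s.Ω j) ∧ s'.Λ (j + 1) = blockUpSet F K (s.Λ j) := by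
  obtain ⟨hΩ, hΛ⟩ := (truncSeq_eq_iff_blockDown F ν hM hR s' s).1 h j h1 hj
  exact ⟨by rw [← hΩ, blockUpSet_blockDownSet_of_mem_dOfRecord_succ F ν M gB K j (s'.chain.memΩ (j + 1) (by omega) (by omega))],
    by rw [← hΛ, blockUpSet_blockDownSet_of_mem_dOfRecord_succ F ν M gB K j (s'.chain.memΛ (j + 1) (by omega) (by omega))]⟩

/-! ## §2 Injectivity on the fibre: a fibre point is determined by its level-1 data -/

/-- **TWO FIBRE POINTS WITH THE SAME LEVEL-1 DATA ARE EQUAL**: the entries above level 1 are forced (§1), level 0 and levels `> k+1` are `∅` by the (2.18) normalisation —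
`Set.InjOn (s′ ↦ (s′.Ω_1, s′.Λ_1)) {s′ : truncSeq s′ = s}` (the flow-free `truncShift` form is n20-w2's `eq_of_truncShift_eq_of_levelOne_eq`, INTENT-2).
[cite: Balaban1988Convergent, (2.18) p.257 (bookkeeping)] -/
theorem injOn_levelOne_truncSeq_fibre (hM : 0 < M) (hR : RAgree F ν gA gB k) (s : Seq (DOfRecord F ν M gA K) k) :
    Set.InjOn (fun s' : Seq (DOfRecord F ν M gB (K + 1)) (k + 1) => (s'.Ω 1, s'.Λ 1)) {s' | truncSeq F ν hM hR s' = s} := by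
  intro s' hs' s'' hs'' h
  have hΩ : s'.Ω 1 = s''.Ω 1 := congrArg Prod.fst h
  have hΛ : s'.Λ 1 = s''.Λ 1 := congrArg Prod.snd h
  apply Seq.ext'
  · funext i
    rcases i with _ | _ | j
    · rw [s'.Ω_off 0 (by omega), s''.Ω_off 0 (by omega)]
    · exact hΩ
    · by_cases hj : j + 1 ≤ k
      · rw [(succ_eq_blockUpSet_of_truncSeq_eq F ν hM hR hs' (by omega) hj).1, (succ_eq_blockUpSet_of_truncSeq_eq F ν hM hR hs'' (by omega) hj).1]
      · rw [s'.Ω_off (j + 2) (by omega), s''.Ω_off (j + 2) (by omega)]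
  · funext i
    rcases i with _ | _ | j
    · rw [s'.Λ_off 0 (by omega), s''.Λ_off 0 (by omega)]
    · exact hΛ
    · by_cases hj : j + 1 ≤ k
      · rw [(succ_eq_blockUpSet_of_truncSeq_eq F ν hM hR hs' (by omega) hj).2, (succ_eq_blockUpSet_of_truncSeq_eq F ν hM hR hs'' (by omega) hj).2]
      · rw [s'.Λ_off (j + 2) (by omega), s''.Λ_off (j + 2) (by omega)]

/-! ## §3 Surjectivity: every admissible level-1 datum above `blockUp (s.Ω_1)` occurs -/

/-- The (2.1) chain laws for «level 1 := the datum `(Ω₁, Λ₁)`, level `j+1` := `blockUp` of level `j` of `s`» (n20-d's `chain21_liftFun` with a general first entry): memberships by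
`blockUpSet_mem_dOfRecord_of_rAgree` and the datum's; `Λ′ ⊆ Ω′` from the datum ∕ monotonicity; `Ω′_{j+2} ⊆ Λ′_{j+1}` from `s`'s chain and, at `j = 0`, from the clause
`blockUp (s.Ω_1) ⊆ Λ₁`. [cite: Balaban1988Convergent, (2.1) p.254 (bookkeeping)] -/
theorem chain21_levelOne (hM : 0 < M) (hR : RAgree F ν gA gB k) (s : Seq (DOfRecord F ν M gA K) k) {Ω₁ Λ₁ : Set (Site (F.P (K + 1)) 0)}
    (hΩ₁ : Ω₁ ∈ DOfRecord F ν M gB (K + 1) 1) (hΛ₁ : Λ₁ ∈ DOfRecord F ν M gB (K + 1) 1) (hsub : Λ₁ ⊆ Ω₁)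
    (hup : 1 ≤ k → blockUpSet F K (s.Ω 1) ⊆ Λ₁) :
    Chain21 (DOfRecord F ν M gB (K + 1)) (k + 1)
      (fun i => if i = 1 then Ω₁ else liftFun F s.Ω i) (fun i => if i = 1 then Λ₁ else liftFun F s.Λ i) where
  memΩ i h1 hi := by
    rcases i with _ | _ | j
    · omega
    · simpa using hΩ₁
    · simp only [show j + 1 + 1 ≠ 1 by omega, if_false]
      rw [liftFun_succ F _ (show 1 ≤ j + 1 by omega)]
      exact blockUpSet_mem_dOfRecord_of_rAgree F ν hM hR (by omega) (by omega) (s.chain.memΩ (j + 1) (by omega) (by omega))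
  memΛ i h1 hi := by
    rcases i with _ | _ | j
    · omega
    · simpa using hΛ₁
    · simp only [show j + 1 + 1 ≠ 1 by omega, if_false]
      rw [liftFun_succ F _ (show 1 ≤ j + 1 by omega)]
      exact blockUpSet_mem_dOfRecord_of_rAgree F ν hM hR (by omega) (by omega) (s.chain.memΛ (j + 1) (by omega) (by omega))
  Λ_subset i h1 hi := by
    rcases i with _ | _ | j
    · omega
    · simpa using hsub
    · simp only [show j + 1 + 1 ≠ 1 by omega, if_false]
      rw [liftFun_succ F _ (show 1 ≤ j + 1 by omega), liftFun_succ F _ (show 1 ≤ j + 1 by omega)]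
      exact blockUpSet_mono F K (s.chain.Λ_subset (j + 1) (by omega) (by omega))
  Ω_succ_subset i h1 hi := by
    rcases i with _ | _ | j
    · omega
    · simp only [show (0 + 1 + 1 : ℕ) ≠ 1 by omega, if_false, if_true]
      rw [show (0 + 1 + 1 : ℕ) = 1 + 1 from rfl, liftFun_succ F _ le_rfl]
      exact hup (by omega)
    · simp only [show j + 1 + 1 + 1 ≠ 1 by omega, show j + 1 + 1 ≠ 1 by omega, if_false]
      rw [liftFun_succ F _ (show 1 ≤ j + 1 + 1 by omega), liftFun_succ F _ (show 1 ≤ j + 1 by omega)]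
      exact blockUpSet_mono F K (s.chain.Ω_succ_subset (j + 1) (by omega) (by omega))

/-- **★ EVERY ADMISSIBLE LEVEL-1 DATUM ABOVE `blockUp (s.Ω_1)` IS THE LEVEL-1 DATUM OF A FIBRE POINT** (no exactness needed): for `Ω₁, Λ₁ ∈ 𝐃^B_1` with `Λ₁ ⊆ Ω₁` and
`blockUp (s.Ω_1) ⊆ Λ₁` (when `k ≥ 1`; the (2.1) clause `Ω′_2 ⊆ Λ′_1`), the index «level 1 := `(Ω₁, Λ₁)`, level `j+1` := `blockUp` of `s`'s level `j`» truncates to `s`.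
[cite: Balaban1988Convergent, (2.1) p.254, (2.18) p.257 (bookkeeping)] -/
theorem exists_truncSeq_eq_of_levelOne (hM : 0 < M) (hR : RAgree F ν gA gB k) (s : Seq (DOfRecord F ν M gA K) k) {Ω₁ Λ₁ : Set (Site (F.P (K + 1)) 0)}
    (hΩ₁ : Ω₁ ∈ DOfRecord F ν M gB (K + 1) 1) (hΛ₁ : Λ₁ ∈ DOfRecord F ν M gB (K + 1) 1) (hsub : Λ₁ ⊆ Ω₁)
    (hup : 1 ≤ k → blockUpSet F K (s.Ω 1) ⊆ Λ₁) :
    ∃ s' : Seq (DOfRecord F ν M gB (K + 1)) (k + 1), truncSeq F ν hM hR s' = s ∧ s'.Ω 1 = Ω₁ ∧ s'.Λ 1 = Λ₁ := by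
  refine ⟨Seq.ofChain _ _ (chain21_levelOne F ν hM hR s hΩ₁ hΛ₁ hsub hup), ?_, ?_, ?_⟩
  · rw [truncSeq_eq_iff_blockDown]
    intro j h1 hj
    rw [Seq.ofChain_Ω _ (by omega) (by omega), Seq.ofChain_Λ _ (by omega) (by omega)]
    simp only [show j + 1 ≠ 1 by omega, if_false]
    rw [liftFun_succ F _ h1, liftFun_succ F _ h1, blockDownSet_blockUpSet, blockDownSet_blockUpSet]
    exact ⟨rfl, rfl⟩
  · rw [Seq.ofChain_Ω _ le_rfl (by omega)]
    simp
  · rw [Seq.ofChain_Λ _ le_rfl (by omega)]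
    simp

/-- **THE NO-LARGE-FIELD DATUM IS n20-d's SECTION**: the level-1 datum of `liftSeq s` is `(T_η, T_η)`. [cite: Balaban1988Convergent, (2.18) p.257 (bookkeeping)] -/
theorem levelOne_liftSeq (hM : 0 < M) (hR : RAgree F ν gA gB k) (s : Seq (DOfRecord F ν M gA K) k) :
    (liftSeq F ν hM hR s).Ω 1 = Set.univ ∧ (liftSeq F ν hM hR s).Λ 1 = Set.univ := by
  constructor
  · exact liftSeq_Ω_one F ν hM hR s
  · unfold liftSeq
    rw [Seq.ofChain_Λ _ le_rfl (by omega), liftFun_one]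

/-! ## §4 The bijection: the fibre IS run B's admissible level-1 data above `blockUp (s.Ω_1)` -/

/-- **★★ NODE U5d's BLOCK-DOWN FIBRE OVER A RUN-A SEQUENCE IS RUN B's ADMISSIBLE LEVEL-1 DATA**: `s′ ↦ (s′.Ω_1, s′.Λ_1)` maps
`{s′ : truncSeq s′ = s}` BIJECTIVELY onto `{(Ω₁, Λ₁) : Ω₁ ∈ 𝐃^B_1, Λ₁ ∈ 𝐃^B_1, Λ₁ ⊆ Ω₁, (1 ≤ k → blockUp (s.Ω_1) ⊆ Λ₁)}` — so the run-B fibre sum of module 1's `hedge`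
sandwich is the sum of run B's (2.18) terms over its FIRST-LEVEL small-∕large-field decomposition compatible with `s` one level up: the partial summation of [King1986] (3.10)
on [III]'s index. [cite: King1986, (3.10) p.656; Balaban1988Convergent, (2.1) p.254, (2.18) p.257; Balaban1987RG1, (0.3) p.252 (bookkeeping)] -/
theorem bijOn_levelOne_truncSeq_fibre (hM : 0 < M) (hR : RAgree F ν gA gB k)
    (s : Seq (DOfRecord F ν M gA K) k) :
    Set.BijOn (fun s' : Seq (DOfRecord F ν M gB (K + 1)) (k + 1) => (s'.Ω 1, s'.Λ 1))
      {s' | truncSeq F ν hM hR s' = s}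
      {p | p.1 ∈ DOfRecord F ν M gB (K + 1) 1 ∧ p.2 ∈ DOfRecord F ν M gB (K + 1) 1 ∧ p.2 ⊆ p.1 ∧ (1 ≤ k → blockUpSet F K (s.Ω 1) ⊆ p.2)} := by
  refine ⟨fun s' hs' => ?_, fun s' hs' s'' hs'' h => ?_, fun p hp => ?_⟩
  · -- maps into: the level-1 datum of a fibre point is admissible and lies above `blockUp (s.Ω 1) = s'.Ω 2`
    have hs : truncSeq F ν hM hR s' = s := hs'
    refine ⟨s'.chain.memΩ 1 le_rfl (by omega), s'.chain.memΛ 1 le_rfl (by omega), s'.chain.Λ_subset 1 le_rfl (by omega), fun hk => ?_⟩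
    have h2 : s'.Ω (1 + 1) = blockUpSet F K (s.Ω 1) := (succ_eq_blockUpSet_of_truncSeq_eq F ν hM hR hs le_rfl hk).1
    rw [← h2]
    exact s'.chain.Ω_succ_subset 1 le_rfl (by omega)
  · -- injective on the fibre
    exact injOn_levelOne_truncSeq_fibre F ν hM hR s hs' hs'' h
  · -- surjective onto the admissible data
    obtain ⟨hΩ₁, hΛ₁, hsub, hup⟩ := hp
    obtain ⟨s', hs', hΩ, hΛ⟩ := exists_truncSeq_eq_of_levelOne F ν hM hR s hΩ₁ hΛ₁ hsub hup
    exact ⟨s', hs', Prod.ext hΩ hΛ⟩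

open Classical in
/-- **COROLLARY: RE-INDEXING THE FIBRE SUM BY LEVEL-1 DATA**: any weight summed over the fibre may be written through the level-1 datum — for `f` on run-B
sequences and any `g` on pairs with `g (s′.Ω_1, s′.Λ_1) = f s′` on the fibre, `Σ_{s′ : truncSeq s′ = s} f s′ = Σ_{p ∈ image} g p` with the image = the admissible data of
`bijOn_levelOne_truncSeq_fibre` (`Finset.sum_image` by §2's injectivity). [cite: King1986, (3.10) p.656; Balaban1988Convergent, (2.18) p.257 (bookkeeping)] -/
theorem sum_truncSeq_fibre_eq_sum_image_levelOne (hM : 0 < M) (hR : RAgree F ν gA gB k)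
    (s : Seq (DOfRecord F ν M gA K) k) {β : Type*} [AddCommMonoid β]
    (g : Set (Site (F.P (K + 1)) 0) × Set (Site (F.P (K + 1)) 0) → β) :
    ∑ s' ∈ Finset.univ.filter (fun s' : Seq (DOfRecord F ν M gB (K + 1)) (k + 1) => truncSeq F ν hM hR s' = s), g (s'.Ω 1, s'.Λ 1)
      = ∑ p ∈ (Finset.univ.filter (fun s' : Seq (DOfRecord F ν M gB (K + 1)) (k + 1) => truncSeq F ν hM hR s' = s)).image
          (fun s' => (s'.Ω 1, s'.Λ 1)), g p := by
  rw [Finset.sum_image]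
  intro s' hs' s'' hs'' h
  exact injOn_levelOne_truncSeq_fibre F ν hM hR s (Finset.mem_filter.mp hs').2 (Finset.mem_filter.mp hs'').2 h

end Summit.QuantumFields.YangMills.BalabanUVNodes.N20TruncSeqFibreLevelOne

end
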